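import Summits.QuantumFields.GaugeBoot.WeakCouplingDeficitRate
import Summits.QuantumFields.GaugeBoot.OneLinkLaplace
import Summits.QuantumFields.GaugeBoot.SpecialUnitaryHaarSmallBall
import Summits.QuantumFields.GaugeBoot.Targets
import Literature.MathematicalPhysics.QuantumFieldTheory.UnitaryCayleyChart
import Literature.MathematicalPhysics.QuantumFieldTheory.AdmissiblePlaquetteWeightProofs
import HarnessLib

/-!
# Gauge-boot: `1 − ⟨ū_P⟩ = O(1/β)` FOR `SU(N)`, EVERY `N ≥ 2`, UNIFORMLY IN THE VOLUME, WITH EXPLICIT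
# CONSTANTS (supplement 21, part 3f, file 2/2 — WHAT REMAINS (lxxvi))

HONEST FRAMING (cell `pub-gaugeboot`, page 1 of every file): certified bounds on lattice
expectations at STATED coupling, gauge group, dimension and torus size; NOT a mass gap, NOT a
continuum limit, NOT a string tension, NOT large `N`; NOT Yang–Mills-summit-bearing (barriers
`FixedCouplingUltralocality`, `PerturbativeInvisibility`).  An analytic weak-coupling bound; at the table
couplings it is weaker than the certificates; it certifies no number.

## Content

The one-link data of `SU(N)` in the dimension `2k = N² − 1 = dim SU(N)`:

* `SUNRateSharp.cost_eq_sum`, `norm_sub_one_sq_le_two_mul_cost`, `cost_le_sq_mul_norm_sq` (with the tree's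
  `l2_opNorm_sq_le_sum_norm_sq`) — for a unitary
  `V`: `N − Re tr V = Σ_{ab}|(1 − V)_{ab}|²/2`, hence `‖V − 1‖²_op/2 ≤ N − Re tr V ≤ N²‖V − 1‖²_op/2`;
* `SUNRateSharp.haar_cost_le` — UPPER small-ball bound `Haar_{SU(N)}{N − Re tr V ≤ t} ≤ A_N t^k`,
  `A_N = π · 20^{N²} · 2^k` (part 3b, `haar_suOpBall_le`); `SUNRateSharp.haar_cost_ge` — LOWER bound
  `Haar_{SU(N)}{N − Re tr V ≤ η} ≥ c_N η^k` for `0 < η ≤ 1/2`, `c_N = 4·(2N²)^{−k}/(Nπ(2π+1)^{N²})`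
  (part 3b, `haar_suOpBall_ge'`);
* ★★★ `SUNRateSharp.one_sub_plaquetteExpectation_le` — for `N ≥ 2`, `D ≥ 2`, EVERY torus side `L` and
  every `β_std ≥ 2N`: **`1 − plaquetteExpectation N D L β_std ≤ (2/β_std) · (16 + (2/D)|a_N + k log 2| +
  (2/(D−1))|b_N| + (2k/((D−1)L)) log(β_std/N))`** with `k = (N²−1)/2`, `a_N = log A_N + log C_k`
  (`Laplace.laplaceConst`), `b_N = log c_N`: the plaquette deficit is **`O(1/β_std)`** with an explicit
  `N`-dependent constant, up to a finite-size `log β/(Lβ)` term;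
* ★★★ `SUNRateSharp.one_sub_integral_plaquette_le_of_mem_limitPoints` — at every infinite-volume limit
  point of the `SU(N)` torus states at `β_std ≥ 2N`, every plaquette:
  **`1 − ∫ (1/N) Re tr U_P dμ ≤ (2/β_std)(16 + (2/D)|a_N + k log 2| + (2/(D−1))|b_N|)`**.

With the equipartition lower bound (supplement 18: `≥ (N²−1)/(4(D−1)β_std + N²−1)`) the `SU(N)` plaquette
deficit is `Θ(1/β_std)` at weak coupling at every infinite-volume limit point — both orders now proved;
the constant here is far from the perturbative `(N²−1)/(Dβ_std)·…` (it is a covering/packing constant),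
the ORDER is the content.  [folklore] (free-energy sandwich; see part 3e.)
-/

noncomputable section

open MeasureTheory Filter Topology
open scoped Matrix Matrix.Norms.L2Operator
open Literature.MathematicalPhysics.QuantumFieldTheory
open Literature.MathematicalPhysics.QuantumLattice (LGConfig plaquetteObs infiniteVolumeLimitPoints fundamentalRep_apply)
open Literature.RepresentationTheory.CompactGroups
open Literature.Barriers.QuantumFields

namespace Summit.QuantumFields.GaugeBoot

namespace SUNRateSharp

variable {N : ℕ}

/-! ### The one-link cost versus the operator norm -/

/-- `Σ_{ab} |A_{ab}|² ≤ N² ‖A‖²_op` (entries are bounded by the operator norm). [folklore] -/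
theorem sum_sq_le_sq_mul_l2_opNorm_sq (A : Matrix (Fin N) (Fin N) ℂ) :
    ∑ i, ∑ j, ‖A i j‖ ^ 2 ≤ (N : ℝ) ^ 2 * ‖A‖ ^ 2 := by
  calc ∑ i, ∑ j, ‖A i j‖ ^ 2 ≤ ∑ _i : Fin N, ∑ _j : Fin N, ‖A‖ ^ 2 :=
        Finset.sum_le_sum fun i _ => Finset.sum_le_sum fun j _ =>
          pow_le_pow_left₀ (norm_nonneg _) (norm_entry_le_l2_opNorm A i j) 2
    _ = (N : ℝ) ^ 2 * ‖A‖ ^ 2 := by simp [Finset.sum_const, Finset.card_univ]; ring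

/-- The one-link cost of a unitary matrix as a sum of squares: `N − Re tr V = Σ_{ab} |(1 − V)_{ab}|²/2`. [folklore] -/
theorem cost_eq_sum {V : Matrix (Fin N) (Fin N) ℂ} (hV : V ∈ Matrix.unitaryGroup (Fin N) ℂ) :
    (N : ℝ) - V.trace.re = (∑ i, ∑ j, ‖(1 - V) i j‖ ^ 2) / 2 := by
  have h := UnitaryCayley.re_trace_one_sub hV
  rw [Matrix.trace_sub, Matrix.trace_one, Complex.sub_re, Fintype.card_fin, Complex.natCast_re] at h
  rw [h, UnitaryCayley.frobenius_norm_sq]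

/-- `‖V − 1‖²_op ≤ 2 (N − Re tr V)` for unitary `V`. [folklore] -/
theorem norm_sub_one_sq_le_two_mul_cost {V : Matrix (Fin N) (Fin N) ℂ} (hV : V ∈ Matrix.unitaryGroup (Fin N) ℂ) :
    ‖V - 1‖ ^ 2 ≤ 2 * ((N : ℝ) - V.trace.re) := by
  rw [cost_eq_sum hV, norm_sub_rev]
  have := l2_opNorm_sq_le_sum_norm_sq (1 - V)
  linarith

/-- `N − Re tr V ≤ N² ‖V − 1‖²_op / 2` for unitary `V`. [folklore] -/
theorem cost_le_sq_mul_norm_sq {V : Matrix (Fin N) (Fin N) ℂ} (hV : V ∈ Matrix.unitaryGroup (Fin N) ℂ) :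
    (N : ℝ) - V.trace.re ≤ (N : ℝ) ^ 2 * ‖V - 1‖ ^ 2 / 2 := by
  rw [cost_eq_sum hV, norm_sub_rev]
  have := sum_sq_le_sq_mul_l2_opNorm_sq (1 - V)
  linarith

/-! ### `SU(N)`: the one-link data -/

/-- The `SU(N)` one-link cost set `{V : N − Re tr V ≤ t}` lies in the operator-norm ball of radius `√(2t)`. -/
theorem costSet_subset_suOpBall (t : ℝ) :
    {V : SU N | (N : ℝ) - ((suRep N V).trace).re ≤ t} ⊆ SUHaar.suOpBall N (Real.sqrt (2 * t)) := by
  intro V hV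
  simp only [Set.mem_setOf_eq, suRep, fundamentalRep_apply] at hV
  have hu := (Matrix.mem_specialUnitaryGroup_iff.1 V.2).1
  have h := norm_sub_one_sq_le_two_mul_cost hu
  show ‖(V : Matrix (Fin N) (Fin N) ℂ) - 1‖ ≤ Real.sqrt (2 * t)
  rw [← Real.sqrt_sq (norm_nonneg _)]
  exact Real.sqrt_le_sqrt (by linarith)

/-- The operator-norm ball of radius `r` lies in `{N − Re tr V ≤ N² r²/2}`. -/
theorem suOpBall_subset_costSet (r : ℝ) :
    SUHaar.suOpBall N r ⊆ {V : SU N | (N : ℝ) - ((suRep N V).trace).re ≤ (N : ℝ) ^ 2 * r ^ 2 / 2} := by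
  intro V hV
  have hV' : ‖(V : Matrix (Fin N) (Fin N) ℂ) - 1‖ ≤ r := hV
  simp only [Set.mem_setOf_eq, suRep, fundamentalRep_apply]
  have hu := (Matrix.mem_specialUnitaryGroup_iff.1 V.2).1
  refine (cost_le_sq_mul_norm_sq hu).trans ?_
  have := pow_le_pow_left₀ (norm_nonneg _) hV' 2
  have hN : (0 : ℝ) ≤ (N : ℝ) ^ 2 := by positivity
  nlinarith

/-- The exponent `k = (N² − 1)/2 = dim SU(N)/2`. -/
def kSU (N : ℕ) : ℝ := (((N * N : ℕ) : ℝ) - 1) / 2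

/-- The constant of the UPPER small-ball bound: `A_N = π · 20^{N²} · 2^k`. -/
def upperConst (N : ℕ) : ℝ := Real.pi * 20 ^ (N * N) * 2 ^ kSU N

/-- The constant of the LOWER small-ball bound: `c_N = (4/(Nπ)) (2π+1)^{−N²} (2N²)^{−k}`. -/
def lowerConst (N : ℕ) : ℝ := 4 / (N * Real.pi) * ((2 * Real.pi + 1) ^ (N * N))⁻¹ * (2 * (N : ℝ) ^ 2) ^ (-kSU N)

/-- `k > 0` for `N ≥ 2`. -/
theorem kSU_pos (hN : 2 ≤ N) : 0 < kSU N := by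
  unfold kSU
  have : (4 : ℝ) ≤ ((N * N : ℕ) : ℝ) := by exact_mod_cast Nat.mul_le_mul hN hN
  linarith

/-- `A_N > 0`. -/
theorem upperConst_pos (N : ℕ) : 0 < upperConst N := by
  unfold upperConst
  have := Real.rpow_pos_of_pos (show (0 : ℝ) < 2 by norm_num) (kSU N)
  positivity

/-- `c_N > 0`. -/
theorem lowerConst_pos (hN : N ≠ 0) : 0 < lowerConst N := by
  unfold lowerConst
  have hNpos : (0 : ℝ) < N := by exact_mod_cast Nat.pos_of_ne_zero hN
  have := Real.rpow_pos_of_pos (show (0 : ℝ) < 2 * (N : ℝ) ^ 2 by positivity) (-kSU N)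
  positivity

/-- ★ **UPPER small-ball bound for the `SU(N)` one-link cost** (`N ≥ 2`): for `t > 0`,
`Haar{V : N − Re tr V ≤ t} ≤ A_N · t^k`. [folklore] -/
theorem haar_cost_le (hN : 2 ≤ N) {t : ℝ} (ht : 0 < t) :
    (haarProbability (SU N)).real {V : SU N | (N : ℝ) - ((suRep N V).trace).re ≤ t} ≤ upperConst N * t ^ kSU N := by
  have hN0 : N ≠ 0 := by omega
  have hk := kSU_pos hN
  set r := Real.sqrt (2 * t) with hr
  have hr0 : 0 < r := Real.sqrt_pos.2 (by linarith)
  have hmono : (haarProbability (SU N)).real {V : SU N | (N : ℝ) - ((suRep N V).trace).re ≤ t} ≤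
      (haarProbability (SU N)).real (SUHaar.suOpBall N r) :=
    measureReal_mono (costSet_subset_suOpBall t) (measure_ne_top _ _)
  refine hmono.trans ?_
  -- `r^{N²−1} = (2t)^k`
  have hrk : r ^ (N * N) = r * (2 * t) ^ kSU N := by
    have hNN : N * N = (N * N - 1) + 1 := by
      have : 1 ≤ N * N := Nat.one_le_iff_ne_zero.2 (Nat.mul_ne_zero hN0 hN0); omega
    have hsq : ∀ n : ℕ, Real.sqrt (2 * t) ^ n = (2 * t) ^ ((n : ℝ) / 2) := fun n => by
      rw [Real.sqrt_eq_rpow, ← Real.rpow_natCast, ← Real.rpow_mul (by linarith)]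
      congr 1; ring
    rw [hNN, pow_succ, mul_comm, hr, hsq]
    congr 2
    unfold kSU
    rw [Nat.cast_sub (Nat.one_le_iff_ne_zero.2 (Nat.mul_ne_zero hN0 hN0))]
    push_cast; ring
  have h2t : (2 * t) ^ kSU N = 2 ^ kSU N * t ^ kSU N := Real.mul_rpow (by norm_num) ht.le
  rcases le_or_gt r Real.pi with hrπ | hrπ
  · have h := SUHaar.haar_suOpBall_le (N := N) hN0 hr0 hrπ
    have h' := ENNReal.toReal_le_of_le_ofReal (by positivity) h
    refine h'.trans (le_of_eq ?_)
    rw [mul_pow, ← mul_assoc, hrk, h2t, upperConst]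
    field_simp
  · -- large `t`: the bound exceeds `1`
    refine (measureReal_le_one (μ := haarProbability (SU N))).trans ?_
    have ht1 : 1 ≤ t ^ kSU N := by
      refine Real.one_le_rpow ?_ hk.le
      have hπ3 : 3 < Real.pi := Real.pi_gt_three
      have : Real.pi ^ 2 < r ^ 2 := by nlinarith
      rw [hr, Real.sq_sqrt (by linarith)] at this
      nlinarith
    have hA1 : 1 ≤ upperConst N := by
      unfold upperConst
      have h20 : (1 : ℝ) ≤ 20 ^ (N * N) := one_le_pow₀ (by norm_num)
      have h2 : (1 : ℝ) ≤ 2 ^ kSU N := Real.one_le_rpow (by norm_num) hk.le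
      have hπ : (1 : ℝ) ≤ Real.pi := by linarith [Real.pi_gt_three]
      calc (1 : ℝ) = 1 * 1 * 1 := by ring
        _ ≤ Real.pi * 20 ^ (N * N) * 2 ^ kSU N := by gcongr
    nlinarith

/-- ★ **LOWER small-ball bound for the `SU(N)` one-link cost** (`N ≥ 2`): for `0 < η ≤ 1/2`,
`c_N · η^k ≤ Haar{V : N − Re tr V ≤ η}`. [folklore] -/
theorem haar_cost_ge (hN : 2 ≤ N) {η : ℝ} (hη : 0 < η) (hη1 : η ≤ 1 / 2) :
    lowerConst N * η ^ kSU N ≤ (haarProbability (SU N)).real {V : SU N | (N : ℝ) - ((suRep N V).trace).re ≤ η} := by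
  have hN0 : N ≠ 0 := by omega
  have hNpos : (0 : ℝ) < N := by exact_mod_cast Nat.pos_of_ne_zero hN0
  have hN1 : (1 : ℝ) ≤ N := by exact_mod_cast Nat.one_le_iff_ne_zero.2 hN0
  -- radius `ρ` with `N² (2ρ)² / 2 = η`
  set ρ : ℝ := Real.sqrt (η / 2) / N with hρ
  have hρ0 : 0 < ρ := div_pos (Real.sqrt_pos.2 (by positivity)) hNpos
  have hρ2 : ρ < 2 := by
    have hs : Real.sqrt (η / 2) ≤ 1 := by
      rw [Real.sqrt_le_one]; linarith
    rw [hρ, div_lt_iff₀ hNpos]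
    nlinarith
  have hsub : SUHaar.suOpBall N (2 * ρ) ⊆ {V : SU N | (N : ℝ) - ((suRep N V).trace).re ≤ η} := by
    refine (suOpBall_subset_costSet (2 * ρ)).trans fun V hV => ?_
    simp only [Set.mem_setOf_eq] at hV ⊢
    refine hV.trans (le_of_eq ?_)
    rw [hρ]
    field_simp
    rw [Real.sq_sqrt (by positivity)]
    ring
  have hmono : (haarProbability (SU N)).real (SUHaar.suOpBall N (2 * ρ)) ≤
      (haarProbability (SU N)).real {V : SU N | (N : ℝ) - ((suRep N V).trace).re ≤ η} :=
    measureReal_mono hsub (measure_ne_top _ _)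
  refine le_trans ?_ hmono
  have h := SUHaar.haar_suOpBall_ge' (N := N) hN0 hρ0 hρ2
  have h' := (ENNReal.ofReal_le_iff_le_toReal (measure_ne_top _ _)).1 h
  rw [measureReal_def]
  refine le_trans ?_ h'
  -- `c_N η^k = (4/(Nπ)) (2π+1)^{−N²} ρ^{N²−1} ≤ (4/(Nπρ)) (ρ/(2π+ρ))^{N²}`
  have hk := kSU_pos hN
  have hNN1 : 1 ≤ N * N := Nat.one_le_iff_ne_zero.2 (Nat.mul_ne_zero hN0 hN0)
  have hρsq : ρ ^ 2 = η / (2 * (N : ℝ) ^ 2) := by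
    rw [hρ, div_pow, Real.sq_sqrt (by positivity)]; field_simp
  have hρpow : ρ ^ (N * N - 1) = (2 * (N : ℝ) ^ 2) ^ (-kSU N) * η ^ kSU N := by
    have h1 : ρ ^ (N * N - 1) = ρ ^ (((N * N - 1 : ℕ) : ℝ)) := (Real.rpow_natCast ρ _).symm
    have h2 : (((N * N - 1 : ℕ) : ℝ)) = 2 * kSU N := by
      unfold kSU; rw [Nat.cast_sub hNN1]; push_cast; ring
    rw [h1, h2, Real.rpow_mul hρ0.le, Real.rpow_two, hρsq, Real.div_rpow hη.le (by positivity),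
      Real.rpow_neg (by positivity), div_eq_mul_inv, mul_comm]
  have hρ1 : ρ ≤ 1 := by
    have hs : Real.sqrt (η / 2) ≤ 1 := by rw [Real.sqrt_le_one]; linarith
    rw [hρ, div_le_one hNpos]; linarith
  have hρNN : ρ ^ (N * N) = ρ * ρ ^ (N * N - 1) := by
    rw [← pow_succ']; congr 1; omega
  calc lowerConst N * η ^ kSU N
      = 4 / (N * Real.pi * ρ) * (ρ * ρ ^ (N * N - 1)) * ((2 * Real.pi + 1) ^ (N * N))⁻¹ := by
        rw [lowerConst, hρpow]; field_simp
    _ = 4 / (N * Real.pi * ρ) * (ρ / (2 * Real.pi + 1)) ^ (N * N) := by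
        rw [← hρNN, div_pow]; ring
    _ ≤ 4 / (N * Real.pi * ρ) * (ρ / (2 * Real.pi + ρ)) ^ (N * N) := by
        gcongr


/-! ### The one-link hypotheses of part 3e for `SU(N)` -/

/-- `a_N = log A_N + log C_k`. -/
def aSU (N : ℕ) : ℝ := Real.log (upperConst N) + Real.log (Laplace.laplaceConst (kSU N))

/-- `b_N = log c_N`. -/
def bSU (N : ℕ) : ℝ := Real.log (lowerConst N)

/-- The Laplace hypothesis `hz` of part 3e for `SU(N)`, `N ≥ 2`. -/
theorem hz_su (hN : 2 ≤ N) {β' : ℝ} (hβ' : 0 < β') :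
    Real.log (∫ g, Peel.weight (suRep N) β' g ∂(haarProbability (SU N))) ≤ aSU N - kSU N * Real.log β' := by
  have hN0 : N ≠ 0 := by omega
  have hc : Measurable fun V : SU N => (N : ℝ) - ((suRep N V).trace).re :=
    (continuous_const.sub (continuous_trace_re (suRep N) (continuous_suRep N))).measurable
  have hc0 : ∀ V : SU N, 0 ≤ (N : ℝ) - ((suRep N V).trace).re := fun V => by
    linarith [re_trace_le_of_continuous (suRep N) (continuous_suRep N) V]
  have hcM : ∀ V : SU N, (N : ℝ) - ((suRep N V).trace).re ≤ 2 * N := fun V => by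
    have h := CompactGroup.abs_re_trace_le_card (suRep N) (continuous_suRep N) V
    rw [Fintype.card_fin] at h
    linarith [(abs_le.1 h).1]
  have h := Laplace.log_integral_exp_neg_mul_le (haarProbability (SU N)) hc hc0 hcM (upperConst_pos N) (kSU_pos hN)
    (fun t ht => haar_cost_le hN ht) hβ'
  unfold Peel.weight aSU
  exact h

/-- The small-ball hypothesis `hq` of part 3e for `SU(N)`, `N ≥ 2`, with `η₀ = 1/2`. -/
theorem hq_su (hN : 2 ≤ N) {η : ℝ} (hη : 0 < η) (hη1 : η ≤ 1 / 2) :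
    0 < (haarProbability (SU N)).real {V : SU N | (N : ℝ) - ((suRep N V).trace).re ≤ η} ∧
      bSU N + kSU N * Real.log η ≤
        Real.log ((haarProbability (SU N)).real {V : SU N | (N : ℝ) - ((suRep N V).trace).re ≤ η}) := by
  have hN0 : N ≠ 0 := by omega
  have h := haar_cost_ge hN hη hη1
  have hpos : 0 < lowerConst N * η ^ kSU N := mul_pos (lowerConst_pos hN0) (Real.rpow_pos_of_pos hη _)
  refine ⟨hpos.trans_le h, ?_⟩
  rw [bSU, ← Real.log_rpow hη, ← Real.log_mul (lowerConst_pos hN0).ne' (Real.rpow_pos_of_pos hη _).ne']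
  exact Real.log_le_log hpos h

/-! ### The theorems -/

/-- ★★★ **`O(1/β)` for `SU(N)` on every torus**: for `N ≥ 2`, `D ≥ 2`, EVERY torus side `L` and every
`β_std ≥ 2N`:
`1 − plaquetteExpectation N D L β_std ≤ (2/β_std)(16 + (2/D)|a_N + k log 2| + (2/(D−1))|b_N| + (2k/((D−1)L)) log(β_std/N))`,
`k = (N²−1)/2`. [folklore] -/
theorem one_sub_plaquetteExpectation_le {N D L : ℕ} [NeZero L] (hN : 2 ≤ N) (hD : 2 ≤ D) {β : ℝ}
    (hβ : 2 * (N : ℝ) ≤ β) :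
    1 - plaquetteExpectation N D L β ≤
      2 / β * (16 + 2 / D * |aSU N + kSU N * Real.log 2| + 2 / ((D : ℝ) - 1) * |bSU N| +
        2 * kSU N / (((D : ℝ) - 1) * L) * Real.log (β / N)) := by
  haveI : NeZero D := ⟨by omega⟩
  haveI := SUHaar.secondCountable_su N
  have hN0 : N ≠ 0 := by omega
  have hNpos : (0 : ℝ) < N := by exact_mod_cast Nat.pos_of_ne_zero hN0
  have hβ' : 2 ≤ β / N := by rw [le_div_iff₀ hNpos]; linarith
  have h := DeficitRate.one_sub_meanPlaquette_le (d := D) (L := L) (suRep N) (continuous_suRep N) hN0 hD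
    (k := kSU N) (a := aSU N) (b := bSU N) (η₀ := 1 / 2) (by norm_num)
    (fun β' hβ' => hz_su hN hβ') (fun η hη hη1 => hq_su hN hη hη1) hβ' (by norm_num; linarith)
  unfold plaquetteExpectation
  refine h.trans (le_of_eq ?_)
  have hβ0 : β ≠ 0 := by linarith
  field_simp

/-- ★★★ **`O(1/β)` for `SU(N)` at every infinite-volume limit point**: for `N ≥ 2`, `D ≥ 2`, `β_std ≥ 2N`,
every `μ ∈ infiniteVolumeLimitPoints (suRep N) (β_std/N)` and every plaquette `(x; i ≠ j)` of `ℤ^D`: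
`1 − ∫ (1/N) Re tr U_P dμ ≤ (2/β_std)(16 + (2/D)|a_N + k log 2| + (2/(D−1))|b_N|)`. [folklore] -/
theorem one_sub_integral_plaquette_le_of_mem_limitPoints {N D : ℕ} (hN : 2 ≤ N) (hD : 2 ≤ D) {β : ℝ}
    (hβ : 2 * (N : ℝ) ≤ β) {μ : Measure (LGConfig D (SU N))}
    (hμ : μ ∈ infiniteVolumeLimitPoints (d := D) (suRep N) (β / N))
    (x : Literature.Probability.LatticeModels.Site D) {i j : Fin D} (hij : i ≠ j) :
    1 - ∫ U, (N : ℝ)⁻¹ * plaquetteObs (suRep N) x i j U ∂μ ≤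
      2 / β * (16 + 2 / D * |aSU N + kSU N * Real.log 2| + 2 / ((D : ℝ) - 1) * |bSU N|) := by
  haveI : NeZero D := ⟨by omega⟩
  haveI := SUHaar.secondCountable_su N
  have hN0 : N ≠ 0 := by omega
  have hNpos : (0 : ℝ) < N := by exact_mod_cast Nat.pos_of_ne_zero hN0
  have hβ' : 2 ≤ β / N := by rw [le_div_iff₀ hNpos]; linarith
  have h := DeficitRate.one_sub_integral_plaquette_le_of_mem_limitPoints (d := D) (suRep N) (continuous_suRep N)
    hN0 hD (k := kSU N) (a := aSU N) (b := bSU N) (η₀ := 1 / 2) (by norm_num)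
    (fun β' hβ' => hz_su hN hβ') (fun η hη hη1 => hq_su hN hη hη1) hβ' (by norm_num; linarith) hμ x hij
  refine h.trans (le_of_eq ?_)
  have hβ0 : β ≠ 0 := by linarith
  field_simp

end SUNRateSharp

end Summit.QuantumFields.GaugeBoot

end
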